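import Summits.ResolutionOfSingularities.ResolutionOfSingularities.Theorems.PurelyInseparableDim4ChartAtlasSNCManyHeights
import HarnessLib

/-!
# Purely inseparable four-folds `z^p + F(x₁, …, x₄)`: THE FAR-RESONANCE REPAIR FOR PAIR-KEYED BOUNDARIES (parallel far members of one
# index) — R1/R4/R5 and the many-heights repair transported from the index-keyed theorems by POINTWISE SUB-BOUNDARIES (cell `res-dim4-pi`,
# typ-2 g7; HANDOFF OPEN 6 «far repair keyed by pairs»)

[OURS · counted 0] (D-0157 DOOR 2; DR-157-C.) The far repair R1–R5 (p706678 … p709208) and its many-heights form (p717520, `…SNCManyHeights`)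
are INDEX-keyed: one translated far quadric `TQ_k = ((y_k + b_k)·y_j − c′·y_k + e_k)·𝒪` per index `k ∈ fs`. The pair-list boundaries of
PA1–PA3c (p709429 … p714892; typ-3's entry point `globalCentre_atlas_package_boundary_nearFar_pairs`) allow PARALLEL far members
`{xᵢ = −d}`, `{xᵢ = −d′}` of one index, which read `TQ_{(k, ε)}`, `TQ_{(k, ε′)}` with `ε ≠ ε′` in R1's frame. KEY REMARK: two translated far
quadrics of one index never meet (their difference is the non-zero constant `ε − ε′`), so through every point of `𝔸⁵` the pair-keyed boundary
`E` has an INDEX-keyed sub-boundary `E_x ⊆ E` containing all members through the point; and `HasSNCWith` is a pointwise condition that only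
sees the members through the point. PROVED here (no `sorry`, no new axiom):

* `hasSNCWith_of_forall_exists_sublist` — **SNC FROM POINTWISE SUB-BOUNDARIES** (any scheme): if through every point `x` some list `E′`
  with `HasSNCWith E′ C` contains all members of `E` through `x`, then `HasSNCWith E C` (the pointwise-varying form of Literature
  `HasSNCWith.of_disjoint`);
* `tquadric_const_eq_of_mem_of_mem`, `exists_indexed_subboundary` — the index-keyed sub-boundary through a point;
* `hasSNCWith_𝓘Λ_insert_of_forall_mem_far_translated_pairs` — R1 (p706678) for pair-keyed boundaries: `Σ = V(y_0, y_T, y_j)` is snc with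
  hyperplanes `(m, a) ∈ H₀` and translated far quadrics `TQ_{(k, ε)}`, `(k, ε) ∈ FE` (`k ≠ j`, `ε + b_k c′ ≠ 0`, provenance `hC1`);
* **`admissible_strictTransform_after_farRepair_pairs`** — R4/R5 (p708880/p709208) for pair-keyed boundaries: after ANY blowing up of `𝔸⁵`
  along `Σ`, `St(V(y_0, y_T))` is regular, inside the support, and snc with the transformed boundary, the height conditions being asked of
  pairs (`hHj`, `hNh` on `(k, ε) ∈ FE` with `k ∈ T`, `ε ≠ 0`; members of one index need no condition among themselves);
* `hasSNCWith_prod_heights_pairs`, **`admissible_strictTransform_after_manyHeights_farRepair_pairs`** — the same for the repair at any finite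
  number of heights (`…SNCManyHeights`) with a pair-keyed boundary.

So the far repair is available in the shape of the pair-list packages (HANDOFF OPEN 6 of typ-2 g6, chart model). Nothing here is a
statement about resolution of singularities in dimension ≥ 4 / characteristic `p` (NOT proved anywhere in this programme). bears_on:
LADDER-RESOLUTION:D157-DOOR2 (res-dim4-pi). Supports stmt-ResolutionOfSingularities-16155 (helper).
-/

-- every declaration of this summit lives under `Summit.ResolutionOfSingularities.ResolutionOfSingularities`
-- (summit = problem), which the duplicate-namespace linter flags; house convention (cf. the Target file).
set_option linter.dupNamespace false

noncomputable section

open MvPolynomial CategoryTheory AlgebraicGeometry TopologicalSpace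
open AlgebraicGeometry.Scheme.IdealSheafData (ofIdealTop)

namespace Summit.ResolutionOfSingularities.ResolutionOfSingularities.Theorems.PIDim4

open Literature.AlgebraicGeometry.Resolution
open Literature.AlgebraicGeometry.Resolution.AffinePointBlowup (P A γ)

namespace ChartDictionary

/-! ## §1 SNC from pointwise sub-boundaries -/

section Generic

universe u

variable {X : Scheme.{u}}

/-- **SNC FROM POINTWISE SUB-BOUNDARIES.** If through every point `x` of `X` there is a list `E′` with `HasSNCWith E′ C` containing every member
of `E` through `x`, then `HasSNCWith E C`: the regular system of parameters adapted to `E′` and `C` at `x` is adapted to `E` (any scheme; the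
pointwise-varying form of Literature `HasSNCWith.of_disjoint`). -/
theorem hasSNCWith_of_forall_exists_sublist {E : List X.IdealSheafData} {C : X.IdealSheafData}
    (h : ∀ x : X, ∃ E' : List X.IdealSheafData, HasSNCWith E' C ∧ ∀ D ∈ E, x ∈ D.support → D ∈ E') : HasSNCWith E C := by
  intro x
  obtain ⟨E', h', hmem⟩ := h x
  obtain ⟨hreg, u, hu, ⟨ι, hι, hιD⟩, hC⟩ := h' x
  refine ⟨hreg, u, hu, ⟨fun D => ι ⟨D.1, hmem D.1 D.2.1 D.2.2, D.2.2⟩, fun D₁ D₂ heq => ?_,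
    fun D => hιD ⟨D.1, hmem D.1 D.2.1 D.2.2, D.2.2⟩⟩, hC⟩
  have e := congrArg Subtype.val (hι heq)
  exact Subtype.ext e

end Generic

/-! ## §2 The index-keyed sub-boundary through a point -/

section Pairs

variable {K : Type} [Field K] {p : ℕ} {T : Finset (Fin 4)} {j : Fin 4} {b : Fin 4 → K} {c' : K}

/-- Two translated far quadrics `TQ_{(k, ε)}`, `TQ_{(k, ε′)}` of one index through one point have `ε = ε′` (their difference is the constant
`ε − ε′`). -/
theorem tquadric_const_eq_of_mem_of_mem (x : P 4 K) {k : Fin 4} {ε ε' : K}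
    (h1 : ((X k.succ + C (b k)) * X j.succ - C c' * X k.succ + C ε : A 4 K) ∈ x.asIdeal)
    (h2 : ((X k.succ + C (b k)) * X j.succ - C c' * X k.succ + C ε' : A 4 K) ∈ x.asIdeal) : ε = ε' := by
  have h := x.asIdeal.sub_mem h1 h2
  have e1 : ((X k.succ + C (b k)) * X j.succ - C c' * X k.succ + C ε - ((X k.succ + C (b k)) * X j.succ - C c' * X k.succ + C ε') :
      A 4 K) = C (ε - ε') := by
    rw [map_sub]; ring
  rw [e1, C_mem_asIdeal_iff, sub_eq_zero] at h
  exact h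

/-- **THE INDEX-KEYED SUB-BOUNDARY THROUGH A POINT.** For a PAIR-keyed chart-model boundary `E` (hyperplanes `(m, a) ∈ H₀`; translated far
quadrics `TQ_{(k, ε)}`, `(k, ε) ∈ FE`, several constants per index allowed) and a point `x` of `𝔸⁵` there are far indices `fs`, constants `e`
with `(k, e k) ∈ FE` on `fs`, and an INDEX-keyed sub-list `E′ ⊆ E` over `(H₀, fs, e)` containing every member of `E` through `x`. -/
theorem exists_indexed_subboundary (x : P 4 K) (H₀ : Finset (Fin (4 + 1) × K)) (FE : Finset (Fin 4 × K))
    {E : List (Scheme.IdealSheafData (P 4 K))}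
    (hE : ∀ D ∈ E, D = ⊤ ∨ (∃ ma ∈ H₀, D = ofIdealTop (Ideal.span {(γ 4 K).symm (X ma.1 + C ma.2)})) ∨
      ∃ kε ∈ FE, D = ofIdealTop (Ideal.span {(γ 4 K).symm ((X kε.1.succ + C (b kε.1)) * X j.succ - C c' * X kε.1.succ + C kε.2)})) :
    ∃ (fs : Finset (Fin 4)) (e : Fin 4 → K) (E' : List (Scheme.IdealSheafData (P 4 K))),
      (∀ k ∈ fs, (k, e k) ∈ FE) ∧ (∀ D ∈ E', D ∈ E) ∧
      (∀ D ∈ E', D = ⊤ ∨ (∃ ma ∈ H₀, D = ofIdealTop (Ideal.span {(γ 4 K).symm (X ma.1 + C ma.2)})) ∨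
        ∃ k ∈ fs, D = ofIdealTop (Ideal.span {(γ 4 K).symm ((X k.succ + C (b k)) * X j.succ - C c' * X k.succ + C (e k))})) ∧
      ∀ D ∈ E, x ∈ D.support → D ∈ E' := by
  classical
  let act : Finset (Fin 4 × K) :=
    FE.filter fun kε => ((X kε.1.succ + C (b kε.1)) * X j.succ - C c' * X kε.1.succ + C kε.2 : A 4 K) ∈ x.asIdeal
  let fs : Finset (Fin 4) := act.image Prod.fst
  have hex : ∀ k ∈ fs, ∃ ε, (k, ε) ∈ act := fun k hk => by
    obtain ⟨kε, hkε, hk1⟩ := Finset.mem_image.mp hk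
    exact ⟨kε.2, by rw [← hk1]; exact hkε⟩
  let e : Fin 4 → K := fun k => if hk : k ∈ fs then (hex k hk).choose else 0
  have he : ∀ k ∈ fs, (k, e k) ∈ act := fun k hk => by
    simp only [e, dif_pos hk]
    exact (hex k hk).choose_spec
  let P' : Scheme.IdealSheafData (P 4 K) → Prop := fun D =>
    D = ⊤ ∨ (∃ ma ∈ H₀, D = ofIdealTop (Ideal.span {(γ 4 K).symm (X ma.1 + C ma.2)})) ∨
      ∃ k ∈ fs, D = ofIdealTop (Ideal.span {(γ 4 K).symm ((X k.succ + C (b k)) * X j.succ - C c' * X k.succ + C (e k))})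
  refine ⟨fs, e, E.filter fun D => decide (P' D), fun k hk => (Finset.mem_filter.mp (he k hk)).1,
    fun D hD => (List.mem_filter.mp hD).1, fun D hD => of_decide_eq_true (List.mem_filter.mp hD).2,
    fun D hD hxD => List.mem_filter.mpr ⟨hD, decide_eq_true ?_⟩⟩
  rcases hE D hD with h | ⟨ma, hma, h⟩ | ⟨kε, hkε, h⟩
  · exact Or.inl h
  · exact Or.inr (Or.inl ⟨ma, hma, h⟩)
  · right; right
    rw [h, mem_support_ofIdealTop_span_γ_symm_iff] at hxD
    have hk : kε.1 ∈ fs := Finset.mem_image.mpr ⟨kε, Finset.mem_filter.mpr ⟨hkε, hxD⟩, rfl⟩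
    refine ⟨kε.1, hk, ?_⟩
    have h2 := (Finset.mem_filter.mp (he kε.1 hk)).2
    rw [h, tquadric_const_eq_of_mem_of_mem x hxD h2]

/-! ## §3 R1 for pair-keyed boundaries -/

/-- **R1 (p706678) FOR A PAIR-KEYED BOUNDARY**: `Σ = V(y_0, y_T, y_j)` (`j ∉ T`, `c′ ≠ 0`) is snc with the hyperplanes `(m, a) ∈ H₀` and the
translated far quadrics `TQ_{(k, ε)}`, `(k, ε) ∈ FE` (`k ≠ j`, `ε + b_k c′ ≠ 0`, provenance `(k⁺, a) ∈ H₀ → a = b_k`), parallel members of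
one index allowed. -/
theorem hasSNCWith_𝓘Λ_insert_of_forall_mem_far_translated_pairs (hjT : j ∉ T) (hc' : c' ≠ 0) (H₀ : Finset (Fin (4 + 1) × K))
    (FE : Finset (Fin 4 × K)) (hjFE : ∀ kε ∈ FE, kε.1 ≠ j) (hd : ∀ kε ∈ FE, kε.2 + b kε.1 * c' ≠ 0)
    (hC1 : ∀ kε ∈ FE, ∀ a : K, (kε.1.succ, a) ∈ H₀ → a = b kε.1) {E : List (Scheme.IdealSheafData (P 4 K))}
    (hE : ∀ D ∈ E, D = ⊤ ∨ (∃ ma ∈ H₀, D = ofIdealTop (Ideal.span {(γ 4 K).symm (X ma.1 + C ma.2)})) ∨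
      ∃ kε ∈ FE, D = ofIdealTop (Ideal.span {(γ 4 K).symm ((X kε.1.succ + C (b kε.1)) * X j.succ - C c' * X kε.1.succ + C kε.2)})) :
    HasSNCWith E (AffineCoordBlowup.𝓘Λ 4 K (insert 0 (Fin.succ '' ((insert j T : Finset (Fin 4)) : Set (Fin 4))))) := by
  refine hasSNCWith_of_forall_exists_sublist fun x => ?_
  obtain ⟨fs, e, E', hfe, -, hE', hsub⟩ := exists_indexed_subboundary (b := b) (c' := c') x H₀ FE hE
  exact ⟨E', hasSNCWith_𝓘Λ_insert_of_forall_mem_far_translated (b := b) (e := e) hjT hc' H₀ fs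
    (fun hj => hjFE _ (hfe j hj) rfl) (fun k hk => hd _ (hfe k hk)) (fun k hk a ha => hC1 _ (hfe k hk) a ha) hE', hsub⟩

/-! ## §4 R4/R5 for pair-keyed boundaries -/

/-- **THE FAR-RESONANCE REPAIR FOR A PAIR-KEYED BOUNDARY** (R4 p708880 + R5 p709208 transported): `j ∉ T`, `c′ ≠ 0`; hyperplanes `(m, a) ∈ H₀`;
translated far quadrics `TQ_{(k, ε)}`, `(k, ε) ∈ FE`; height conditions ON PAIRS: no index-`j` hyperplane `y_j + a` (`a ≠ 0`) at the height
of an active pair (`k ∈ T`, `ε ≠ 0`), and active pairs of DIFFERENT indices have distinct heights (pairs of one index never meet — no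
condition); `z^p + F` `T`-permissible, `T ≠ ∅`. Then for ANY blowing up `π′` of `𝔸⁵` along `Σ`: `C' = St(V(y_0, y_T))` is REGULAR,
`V(C') ⊆ supp M'` for `M' = ((z^p + F)·𝒪, E, p).transform π′ 𝓘_Σ`, and `HasSNCWith M'.boundary C'`. -/
theorem admissible_strictTransform_after_farRepair_pairs (hjT : j ∉ T) (hc' : c' ≠ 0) (H₀ : Finset (Fin (4 + 1) × K))
    (FE : Finset (Fin 4 × K)) (hjFE : ∀ kε ∈ FE, kε.1 ≠ j) (hd : ∀ kε ∈ FE, kε.2 + b kε.1 * c' ≠ 0)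
    (hC1 : ∀ kε ∈ FE, ∀ a : K, (kε.1.succ, a) ∈ H₀ → a = b kε.1)
    (hHj : ∀ a : K, (j.succ, a) ∈ H₀ → a ≠ 0 → ∀ kε ∈ FE, kε.1 ∈ T → kε.2 ≠ 0 → b kε.1 ≠ 0 → kε.2 ≠ a * b kε.1)
    (hNh : ∀ kε ∈ FE, ∀ kε' ∈ FE, kε.1 ∈ T → kε'.1 ∈ T → kε.2 ≠ 0 → kε'.2 ≠ 0 → kε.1 ≠ kε'.1 → b kε.1 ≠ 0 → b kε'.1 ≠ 0 →
      kε.2 * b kε'.1 ≠ kε'.2 * b kε.1)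
    {k₀ : Fin 4} (hk₀ : k₀ ∈ T) {E : List (Scheme.IdealSheafData (P 4 K))}
    (hE : ∀ D ∈ E, D = ⊤ ∨ (∃ ma ∈ H₀, D = ofIdealTop (Ideal.span {(γ 4 K).symm (X ma.1 + C ma.2)})) ∨
      ∃ kε ∈ FE, D = ofIdealTop (Ideal.span {(γ 4 K).symm ((X kε.1.succ + C (b kε.1)) * X j.succ - C c' * X kε.1.succ + C kε.2)}))
    (F : MvPolynomial (Fin 4) K) (hperm : (p : ℕ∞) ≤ CentreBlowup.ordAlong T F) {W' : Scheme.{0}} {π' : W' ⟶ P 4 K}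
    (hπ' : IsBlowup π' (AffineCoordBlowup.𝓘Λ 4 K (insert 0 (Fin.succ '' ((insert j T : Finset (Fin 4)) : Set (Fin 4)))))) :
    let M' := (⟨hypSheaf p F, E, p⟩ : MarkedIdeal (P 4 K)).transform π'
      (AffineCoordBlowup.𝓘Λ 4 K (insert 0 (Fin.succ '' ((insert j T : Finset (Fin 4)) : Set (Fin 4)))))
    let C' := strictTransformIdeal π' (AffineCoordBlowup.𝓘Λ 4 K (insert 0 (Fin.succ '' ((insert j T : Finset (Fin 4)) : Set (Fin 4)))))
      (AffineCoordBlowup.𝓘Λ 4 K (insert 0 (Fin.succ '' (T : Set (Fin 4)))))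
    Scheme.IsRegular C'.subscheme ∧ (C'.support : Set W') ⊆ M'.support ∧ HasSNCWith M'.boundary C' := by
  intro M' C'
  -- regularity and support do not see the boundary: R5 with the empty boundary
  obtain ⟨hreg, hsupp, -⟩ := admissible_strictTransform_after_farRepair (b := b) (e := fun _ => (0 : K)) (c' := c') hjT hc' ∅ ∅
    (Finset.notMem_empty j) (fun k hk => absurd hk (Finset.notMem_empty k)) (fun k hk => absurd hk (Finset.notMem_empty k))
    (fun a ha => absurd ha (Finset.notMem_empty _)) (fun k hk => absurd hk (Finset.notMem_empty k)) hk₀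
    (E := ([] : List (Scheme.IdealSheafData (P 4 K)))) (fun D hD => by simp at hD) F hperm hπ'
  refine ⟨hreg, hsupp, ?_⟩
  rw [MarkedIdeal.transform_boundary]
  refine hasSNCWith_of_forall_exists_sublist fun w => ?_
  obtain ⟨fs, e, E', hfe, -, hE', hsub⟩ := exists_indexed_subboundary (b := b) (c' := c') (π' w) H₀ FE hE
  refine ⟨E'.map (strictTransformIdeal π' (AffineCoordBlowup.𝓘Λ 4 K (insert 0 (Fin.succ '' ((insert j T : Finset (Fin 4)) :
      Set (Fin 4)))))) ++ [(AffineCoordBlowup.𝓘Λ 4 K (insert 0 (Fin.succ '' ((insert j T : Finset (Fin 4)) : Set (Fin 4))))).comap π'],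
    ?_, ?_⟩
  · exact hasSNCWith_transform_boundary_strictTransform_after_farRepair (b := b) (e := e) hjT hc' H₀ fs
      (fun hj => hjFE _ (hfe j hj) rfl) (fun k hk => hd _ (hfe k hk)) (fun k hk a ha => hC1 _ (hfe k hk) a ha)
      (fun a ha ha0 k hk hkT hek hbk => hHj a ha ha0 _ (hfe k hk) hkT hek hbk)
      (fun k hk k' hk' hkT hk'T hek hek' hkk hbk hbk' => hNh _ (hfe k hk) _ (hfe k' hk') hkT hk'T hek hek' hkk hbk hbk') hE' hπ'
  · intro D' hD' hw
    rcases List.mem_append.mp hD' with hD' | hD'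
    · obtain ⟨D, hD, rfl⟩ := List.mem_map.mp hD'
      exact List.mem_append.mpr (Or.inl (List.mem_map.mpr
        ⟨D, hsub D hD (mem_support_of_mem_support_strictTransformIdeal hw), rfl⟩))
    · exact List.mem_append.mpr (Or.inr hD')

/-! ## §5 The repair at any finite number of heights, pair-keyed boundary -/

/-- The pair-keyed chart-model boundary is snc with the repair centre `C(hs) = Π_{h ∈ hs} ψ_{−h}^*𝓘(Σ′)` (pairwise distinct heights `hs ≠ []`,
each `≠ c′`). -/
theorem hasSNCWith_prod_heights_pairs (hjT : j ∉ T) (hs : List K) (hne : hs ≠ []) (hnd : hs.Nodup) (hch : ∀ h ∈ hs, c' - h ≠ 0)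
    (H₀ : Finset (Fin (4 + 1) × K)) (FE : Finset (Fin 4 × K)) (hjFE : ∀ kε ∈ FE, kε.1 ≠ j) (hd : ∀ kε ∈ FE, kε.2 + b kε.1 * c' ≠ 0)
    (hC1 : ∀ kε ∈ FE, ∀ a : K, (kε.1.succ, a) ∈ H₀ → a = b kε.1) {E : List (Scheme.IdealSheafData (P 4 K))}
    (hE : ∀ D ∈ E, D = ⊤ ∨ (∃ ma ∈ H₀, D = ofIdealTop (Ideal.span {(γ 4 K).symm (X ma.1 + C ma.2)})) ∨
      ∃ kε ∈ FE, D = ofIdealTop (Ideal.span {(γ 4 K).symm ((X kε.1.succ + C (b kε.1)) * X j.succ - C c' * X kε.1.succ + C kε.2)})) :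
    HasSNCWith E (hs.map fun h => (AffineCoordBlowup.𝓘Λ 4 K (insert 0 (Fin.succ '' ((insert j T : Finset (Fin 4)) : Set (Fin 4))))).comap
      (Spec.map (CommRingCat.ofHom ((AffinePointBlowup.translateEquiv (n := 4) (Pi.single j.succ (-h)) : A 4 K ≃ₐ[K] A 4 K) :
        A 4 K →+* A 4 K)))).prod := by
  refine hasSNCWith_of_forall_exists_sublist fun x => ?_
  obtain ⟨fs, e, E', hfe, -, hE', hsub⟩ := exists_indexed_subboundary (b := b) (c' := c') x H₀ FE hE
  exact ⟨E', hasSNCWith_prod_heights (b := b) (e := e) hjT hs hne hnd hch H₀ fs (fun hj => hjFE _ (hfe j hj) rfl)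
    (fun k hk => hd _ (hfe k hk)) (fun k hk a ha => hC1 _ (hfe k hk) a ha) hE', hsub⟩

/-- **THE FAR-RESONANCE REPAIR AT ANY FINITE NUMBER OF HEIGHTS FOR A PAIR-KEYED BOUNDARY** (`…SNCManyHeights` transported): heights `hs ≠ []`
pairwise distinct, each `≠ c′`; height conditions on pairs asked only off the heights of `hs`. For ANY blowing up `π` of `𝔸⁵` along `C(hs)`:
`C' = St_π(V(y_0, y_T))` is REGULAR, inside `supp(((z^p + F)·𝒪, E, p).transform π C(hs))`, and snc with the transformed boundary. -/
theorem admissible_strictTransform_after_manyHeights_farRepair_pairs (hjT : j ∉ T) (hs : List K) (hne : hs ≠ []) (hnd : hs.Nodup)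
    (hch : ∀ h ∈ hs, c' - h ≠ 0) (H₀ : Finset (Fin (4 + 1) × K)) (FE : Finset (Fin 4 × K)) (hjFE : ∀ kε ∈ FE, kε.1 ≠ j)
    (hd : ∀ kε ∈ FE, kε.2 + b kε.1 * c' ≠ 0) (hC1 : ∀ kε ∈ FE, ∀ a : K, (kε.1.succ, a) ∈ H₀ → a = b kε.1)
    (hHj : ∀ a : K, (j.succ, a) ∈ H₀ → (∀ h ∈ hs, a + h ≠ 0) →
      ∀ kε ∈ FE, kε.1 ∈ T → (∀ h ∈ hs, kε.2 + b kε.1 * h ≠ 0) → b kε.1 ≠ 0 → kε.2 ≠ a * b kε.1)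
    (hNh : ∀ kε ∈ FE, ∀ kε' ∈ FE, kε.1 ∈ T → kε'.1 ∈ T → (∀ h ∈ hs, kε.2 + b kε.1 * h ≠ 0) →
      (∀ h ∈ hs, kε'.2 + b kε'.1 * h ≠ 0) → kε.1 ≠ kε'.1 → b kε.1 ≠ 0 → b kε'.1 ≠ 0 → kε.2 * b kε'.1 ≠ kε'.2 * b kε.1)
    {k₀ : Fin 4} (hk₀ : k₀ ∈ T) {E : List (Scheme.IdealSheafData (P 4 K))}
    (hE : ∀ D ∈ E, D = ⊤ ∨ (∃ ma ∈ H₀, D = ofIdealTop (Ideal.span {(γ 4 K).symm (X ma.1 + C ma.2)})) ∨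
      ∃ kε ∈ FE, D = ofIdealTop (Ideal.span {(γ 4 K).symm ((X kε.1.succ + C (b kε.1)) * X j.succ - C c' * X kε.1.succ + C kε.2)}))
    (F : MvPolynomial (Fin 4) K) (hperm : (p : ℕ∞) ≤ CentreBlowup.ordAlong T F) {W : Scheme.{0}} {π : W ⟶ P 4 K}
    (hπ : IsBlowup π (hs.map fun h => (AffineCoordBlowup.𝓘Λ 4 K (insert 0 (Fin.succ '' ((insert j T : Finset (Fin 4)) : Set (Fin 4))))).comap
      (Spec.map (CommRingCat.ofHom ((AffinePointBlowup.translateEquiv (n := 4) (Pi.single j.succ (-h)) : A 4 K ≃ₐ[K] A 4 K) :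
        A 4 K →+* A 4 K)))).prod) :
    let Cn := (hs.map fun h => (AffineCoordBlowup.𝓘Λ 4 K (insert 0 (Fin.succ '' ((insert j T : Finset (Fin 4)) : Set (Fin 4))))).comap
      (Spec.map (CommRingCat.ofHom ((AffinePointBlowup.translateEquiv (n := 4) (Pi.single j.succ (-h)) : A 4 K ≃ₐ[K] A 4 K) :
        A 4 K →+* A 4 K)))).prod
    let M' := (⟨hypSheaf p F, E, p⟩ : MarkedIdeal (P 4 K)).transform π Cn
    let C' := strictTransformIdeal π Cn (AffineCoordBlowup.𝓘Λ 4 K (insert 0 (Fin.succ '' (T : Set (Fin 4)))))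
    Scheme.IsRegular C'.subscheme ∧ (C'.support : Set W) ⊆ M'.support ∧ HasSNCWith M'.boundary C' := by
  intro Cn M' C'
  -- regularity and support: the index-keyed theorem with the empty boundary
  obtain ⟨hreg, hsupp, -⟩ := admissible_strictTransform_after_manyHeights_farRepair (b := b) (e := fun _ => (0 : K)) (c' := c') hjT
    hs hne hnd hch ∅ ∅ (Finset.notMem_empty j) (fun k hk => absurd hk (Finset.notMem_empty k))
    (fun k hk => absurd hk (Finset.notMem_empty k)) (fun a ha => absurd ha (Finset.notMem_empty _))
    (fun k hk => absurd hk (Finset.notMem_empty k)) hk₀ (E := ([] : List (Scheme.IdealSheafData (P 4 K))))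
    (fun D hD => by simp at hD) F hperm rfl hπ
  refine ⟨hreg, hsupp, ?_⟩
  rw [MarkedIdeal.transform_boundary]
  refine hasSNCWith_of_forall_exists_sublist fun w => ?_
  obtain ⟨fs, e, E', hfe, -, hE', hsub⟩ := exists_indexed_subboundary (b := b) (c' := c') (π w) H₀ FE hE
  obtain ⟨-, -, hsnc⟩ := admissible_strictTransform_after_manyHeights_farRepair (b := b) (e := e) (c' := c') hjT hs hne hnd hch H₀ fs
    (fun hj => hjFE _ (hfe j hj) rfl) (fun k hk => hd _ (hfe k hk)) (fun k hk a ha => hC1 _ (hfe k hk) a ha)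
    (fun a ha hah k hk hkT hek hbk => hHj a ha hah _ (hfe k hk) hkT hek hbk)
    (fun k hk k' hk' hkT hk'T hek hek' hkk hbk hbk' => hNh _ (hfe k hk) _ (hfe k' hk') hkT hk'T hek hek' hkk hbk hbk') hk₀ hE' F hperm
    rfl hπ
  refine ⟨E'.map (strictTransformIdeal π Cn) ++ [Cn.comap π], hsnc, ?_⟩
  intro D' hD' hw
  rcases List.mem_append.mp hD' with hD' | hD'
  · obtain ⟨D, hD, rfl⟩ := List.mem_map.mp hD'
    exact List.mem_append.mpr (Or.inl (List.mem_map.mpr ⟨D, hsub D hD (mem_support_of_mem_support_strictTransformIdeal hw), rfl⟩))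
  · exact List.mem_append.mpr (Or.inr hD')

end Pairs

end ChartDictionary

end Summit.ResolutionOfSingularities.ResolutionOfSingularities.Theorems.PIDim4

end
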